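import Mathlib
import Summits.AtomisticToContinuum.HydrodynamicLimit.Theorems.ImplosionDichotomyDenseExcursionSonicSmoothBranchCkEuler
import Summits.AtomisticToContinuum.HydrodynamicLimit.Theorems.ImplosionDichotomyDenseExcursionCavityCentreEuler

/-!
# The Euler operator with a complex weight `t^a`, `Re a ≥ 0` (smooth branch at the sonic point without loss of derivatives)
# (crux `DenseExcursion`, line `sonic-cavity-renewal`, brick for stub `stub_cavityResolventCk`, theorem T6b)

Helper file (`--supports stmt-AtomisticToContinuum-12586`, line lead a2, stub-worker E1 for `stub_cavityResolventCk`).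
For the real spectral parameters `Λ` of the cavity resolvent with Frobenius exponent `Re ν(Λ) ≤ −1` at the repulsive sonic
point (in particular the apparent resonances `ν = −m`, `m ≥ 1`, where the second analytic Frobenius branch does not exist)
the smooth branch needs NO Taylor subtraction: the scalar model `R·Y′ = νY + h` is solved by the Euler operator
`(E_a h)(R) = ∫₀¹ t^a h(Rt) dt`, `a = −ν − 1`, `Re a ≥ 0`, whose complex weight is BOUNDED (`|t^a| = t^{Re a} ≤ 1`).
This file is the complex-weight analogue of `…CavityCentreEuler` (integer weight `t^{m−1}`):

* `continuous_eulerCpow`, `norm_eulerCpow_le` — continuity in `R` for continuous `h` (dominated convergence) and the sup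
  bound `‖E_a h(R)‖ ≤ sup_{|s|≤|R|}‖h‖`;
* `hasDerivAt_eulerCpow` — `(E_a h)′ = E_{a+1}(h′)` for `h ∈ C¹` (differentiation under the integral);
* `contDiff_eulerCpow` — `h ∈ C^n ⇒ E_a h ∈ C^n` (induction on `n`, all `a` with `Re a ≥ 0`), and `contDiff_eulerCpow'`
  for `n : ℕ∞`;
* `eulerCpow_identity` — `R·(E_a h)′(R) = −(a+1)·E_a h(R) + h(R)` (integration by parts; the boundary term at `t = 0`
  vanishes because `Re(a+1) > 0`);
* the LOCAL versions on `(−δ, δ)` by smooth cut-off: `contDiffOn_eulerCpow_local`, `eulerCpow_local` (registered helper).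

Sources: folklore (Coddington–Levinson 1955 Ch. 4 §2). Everything proved; no new definitions.
-/

noncomputable section

open Set Filter MeasureTheory intervalIntegral
open scoped Topology ContDiff Interval

namespace Summit.AtomisticToContinuum.HydrodynamicLimit.Theorems.SonicCavityRenewal

/-! ## The weight and the integrand -/

/-- `‖t^a‖ ≤ 1` for `0 < t ≤ 1` and `Re a ≥ 0`. [folklore] -/
theorem norm_ofReal_cpow_le_one {a : ℂ} (ha : 0 ≤ a.re) {t : ℝ} (ht : t ∈ Ioc (0 : ℝ) 1) : ‖(t : ℂ) ^ a‖ ≤ 1 := by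
  rw [Complex.norm_cpow_eq_rpow_re_of_pos ht.1]
  exact Real.rpow_le_one ht.1.le ht.2 ha

/-- The integrand `t ↦ t^a g(Rt)` is a.e.-strongly measurable on `Ι 0 1` for continuous `g`. [folklore] -/
theorem eulerCpow_meas (a : ℂ) {g : ℝ → ℂ} (hg : Continuous g) (R : ℝ) :
    AEStronglyMeasurable (fun t : ℝ => (t : ℂ) ^ a * g (R * t)) (volume.restrict (Ι (0 : ℝ) 1)) := by
  rw [uIoc_of_le zero_le_one]
  refine ContinuousOn.aestronglyMeasurable (fun t ht => ?_) measurableSet_Ioc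
  exact ((Complex.continuousAt_ofReal_cpow_const t a (Or.inr ht.1.ne')).mul
    (hg.continuousAt.comp (continuous_const.mul continuous_id).continuousAt)).continuousWithinAt

/-- The integrand bound: `‖t^a g(Rt)‖ ≤ C` on `0 < t ≤ 1` if `|R| ≤ r` and `‖g‖ ≤ C` on `[−r, r]`. [folklore] -/
theorem eulerCpow_bound {a : ℂ} (ha : 0 ≤ a.re) {g : ℝ → ℂ} {R r C : ℝ} (hR : |R| ≤ r)
    (hC : ∀ s, |s| ≤ r → ‖g s‖ ≤ C) {t : ℝ} (ht : t ∈ Ioc (0 : ℝ) 1) : ‖(t : ℂ) ^ a * g (R * t)‖ ≤ C := by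
  have hC0 : 0 ≤ C := (norm_nonneg _).trans (hC 0 (by rw [abs_zero]; exact (abs_nonneg R).trans hR))
  have hRt : |R * t| ≤ r := by
    rw [abs_mul, abs_of_pos ht.1]; exact (mul_le_of_le_one_right (abs_nonneg R) ht.2).trans hR
  rw [norm_mul]
  calc ‖(t : ℂ) ^ a‖ * ‖g (R * t)‖ ≤ 1 * C := mul_le_mul (norm_ofReal_cpow_le_one ha ht) (hC _ hRt) (norm_nonneg _)
        zero_le_one
    _ = C := one_mul C

/-- A continuous function is bounded on `[−r, r]` by a non-negative constant, in the form `|s| ≤ r → ‖g s‖ ≤ C`.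
[folklore] -/
theorem exists_bound_abs_le {g : ℝ → ℂ} (hg : Continuous g) (r : ℝ) : ∃ C : ℝ, 0 ≤ C ∧ ∀ s, |s| ≤ r → ‖g s‖ ≤ C := by
  obtain ⟨C, hC⟩ := (isCompact_Icc (a := -r) (b := r)).exists_bound_of_continuousOn hg.continuousOn
  exact ⟨max C 0, le_max_right _ _, fun s hs => (hC s ⟨by linarith [(abs_le.1 hs).1], (abs_le.1 hs).2⟩).trans
    (le_max_left _ _)⟩

/-! ## Continuity and the sup bound -/

/-- CONTINUITY OF THE EULER OPERATOR IN THE PARAMETER for continuous `g` (dominated convergence, bound `sup‖g‖` on a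
compact interval). [folklore] -/
theorem continuous_eulerCpow {a : ℂ} (ha : 0 ≤ a.re) {g : ℝ → ℂ} (hg : Continuous g) :
    Continuous fun R => ∫ t in (0 : ℝ)..1, (t : ℂ) ^ a * g (R * t) := by
  refine continuous_iff_continuousAt.2 fun R₀ => ?_
  obtain ⟨C, -, hC⟩ := exists_bound_abs_le hg (|R₀| + 1)
  refine intervalIntegral.continuousAt_of_dominated_interval (bound := fun _ => C)
    (Eventually.of_forall fun R => eulerCpow_meas a hg R) ?_ intervalIntegrable_const ?_
  · filter_upwards [Ioo_mem_nhds (show R₀ - 1 < R₀ by linarith) (show R₀ < R₀ + 1 by linarith)] with R hR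
    refine Eventually.of_forall fun t ht => ?_
    rw [uIoc_of_le zero_le_one] at ht
    refine eulerCpow_bound ha ?_ hC ht
    rw [abs_le]; constructor <;> linarith [hR.1, hR.2, le_abs_self R₀, neg_abs_le R₀]
  · exact Eventually.of_forall fun t _ =>
      (continuous_const.mul (hg.comp (continuous_id.mul continuous_const))).continuousAt

/-- THE SUP BOUND: `‖E_a g(R)‖ ≤ C` if `‖g s‖ ≤ C` for `|s| ≤ |R|`. [folklore] -/
theorem norm_eulerCpow_le {a : ℂ} (ha : 0 ≤ a.re) {g : ℝ → ℂ} {R C : ℝ} (hC : ∀ s, |s| ≤ |R| → ‖g s‖ ≤ C) :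
    ‖∫ t in (0 : ℝ)..1, (t : ℂ) ^ a * g (R * t)‖ ≤ C := by
  have hb : ∀ t ∈ Ι (0 : ℝ) 1, ‖(t : ℂ) ^ a * g (R * t)‖ ≤ C := fun t ht =>
    eulerCpow_bound ha le_rfl hC (by rwa [uIoc_of_le zero_le_one] at ht)
  calc ‖∫ t in (0 : ℝ)..1, (t : ℂ) ^ a * g (R * t)‖ ≤ C * |1 - 0| := norm_integral_le_of_norm_le_const hb
    _ = C := by simp

/-! ## Differentiation under the integral -/

/-- THE DERIVATIVE OF THE EULER OPERATOR: for `g ∈ C¹` and `Re a ≥ 0`,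
`d/dR ∫₀¹ t^a g(Rt) dt = ∫₀¹ t^{a+1} g′(Rt) dt`. [folklore] -/
theorem hasDerivAt_eulerCpow {a : ℂ} (ha : 0 ≤ a.re) {g : ℝ → ℂ} (hg : ContDiff ℝ 1 g) (R₀ : ℝ) :
    HasDerivAt (fun R => ∫ t in (0 : ℝ)..1, (t : ℂ) ^ a * g (R * t))
      (∫ t in (0 : ℝ)..1, (t : ℂ) ^ (a + 1) * deriv g (R₀ * t)) R₀ := by
  have hgc : Continuous g := hg.continuous
  have hg' : Continuous (deriv g) := hg.continuous_deriv le_rfl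
  have hgd : ∀ x, HasDerivAt g (deriv g x) x := fun x => (hg.differentiable (by simp) x).hasDerivAt
  obtain ⟨C, -, hC⟩ := exists_bound_abs_le hg' (|R₀| + 1)
  have hS : Ioo (R₀ - 1) (R₀ + 1) ∈ 𝓝 R₀ := Ioo_mem_nhds (by linarith) (by linarith)
  have habs : ∀ R ∈ Ioo (R₀ - 1) (R₀ + 1), |R| ≤ |R₀| + 1 := fun R hR => by
    rw [abs_le]; constructor <;> linarith [hR.1, hR.2, le_abs_self R₀, neg_abs_le R₀]
  -- integrability of the integrand at `R₀`
  have hint : IntervalIntegrable (fun t : ℝ => (t : ℂ) ^ a * g (R₀ * t)) volume 0 1 := by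
    obtain ⟨C₀, -, hC₀⟩ := exists_bound_abs_le hgc |R₀|
    refine IntervalIntegrable.mono_fun' (intervalIntegrable_const (c := C₀)) (eulerCpow_meas a hgc R₀) ?_
    rw [EventuallyLE, ae_restrict_iff' measurableSet_uIoc]
    exact Eventually.of_forall fun t ht => eulerCpow_bound ha le_rfl hC₀ (by rwa [uIoc_of_le zero_le_one] at ht)
  have hshift : ∀ (x t : ℝ), 0 < t → (t : ℂ) ^ a * ((t : ℝ) • deriv g (x * t)) = (t : ℂ) ^ (a + 1) * deriv g (x * t) :=
    fun x t ht => by rw [Complex.real_smul, ← mul_assoc, ofReal_cpow_mul_self ht]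
  have key := intervalIntegral.hasDerivAt_integral_of_dominated_loc_of_deriv_le (μ := volume) (a := (0 : ℝ)) (b := 1)
    (bound := fun _ => C) (F := fun (x : ℝ) (t : ℝ) => (t : ℂ) ^ a * g (x * t))
    (F' := fun (x : ℝ) (t : ℝ) => (t : ℂ) ^ a * ((t : ℝ) • deriv g (x * t))) hS
    (Eventually.of_forall fun R => eulerCpow_meas a hgc R) hint ?_ ?_ intervalIntegrable_const ?_
  · have heq : (∫ t in (0 : ℝ)..1, (t : ℂ) ^ a * ((t : ℝ) • deriv g (R₀ * t))) =
        ∫ t in (0 : ℝ)..1, (t : ℂ) ^ (a + 1) * deriv g (R₀ * t) :=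
      integral_congr_ae (Eventually.of_forall fun t ht => hshift R₀ t (by rw [uIoc_of_le zero_le_one] at ht; exact ht.1))
    simpa only [heq] using key.2
  · refine (eulerCpow_meas (a + 1) hg' R₀).congr ?_
    rw [EventuallyEq, ae_restrict_iff' measurableSet_uIoc]
    exact Eventually.of_forall fun t ht => (hshift R₀ t (by rw [uIoc_of_le zero_le_one] at ht; exact ht.1)).symm
  · refine Eventually.of_forall fun t ht x hx => ?_
    rw [uIoc_of_le zero_le_one] at ht
    rw [hshift x t ht.1]
    exact eulerCpow_bound (a := a + 1) (by simp only [Complex.add_re, Complex.one_re]; linarith) (habs x hx) hC ht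
  · refine Eventually.of_forall fun t _ x _ => ?_
    exact ((hgd (x * t)).scomp x (hasDerivAt_mul_const t)).const_mul _

/-! ## Smoothness -/

/-- SMOOTHNESS OF THE EULER OPERATOR: `g ∈ C^n ⇒ E_a g ∈ C^n` for every `a` with `Re a ≥ 0` (induction on `n`:
`(E_a g)′ = E_{a+1}(g′)`). [folklore] -/
theorem contDiff_eulerCpow : ∀ (n : ℕ) (a : ℂ) (g : ℝ → ℂ), 0 ≤ a.re → ContDiff ℝ n g →
    ContDiff ℝ n (fun R => ∫ t in (0 : ℝ)..1, (t : ℂ) ^ a * g (R * t)) := by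
  intro n
  induction n with
  | zero =>
    intro a g ha hg
    exact contDiff_zero.2 (continuous_eulerCpow ha hg.continuous)
  | succ n ih =>
    intro a g ha hg
    have hg1 : ContDiff ℝ 1 g := hg.of_le (by exact_mod_cast Nat.le_add_left 1 n)
    have hd := fun R => hasDerivAt_eulerCpow ha hg1 R
    rw [show ((n + 1 : ℕ) : WithTop ℕ∞) = (n : WithTop ℕ∞) + 1 by push_cast; ring] at hg ⊢
    rw [contDiff_succ_iff_deriv] at hg ⊢
    refine ⟨fun R => (hd R).differentiableAt, fun h => absurd h (by simp), ?_⟩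
    have hderiv : deriv (fun R => ∫ t in (0 : ℝ)..1, (t : ℂ) ^ a * g (R * t)) =
        fun R => ∫ t in (0 : ℝ)..1, (t : ℂ) ^ (a + 1) * deriv g (R * t) := funext fun R => (hd R).deriv
    rw [hderiv]
    exact ih (a + 1) (deriv g) (by simp only [Complex.add_re, Complex.one_re]; linarith) hg.2.2

/-- The same for every `n : ℕ∞` (in particular `n = ∞`). [folklore] -/
theorem contDiff_eulerCpow' {n : ℕ∞} {a : ℂ} {g : ℝ → ℂ} (ha : 0 ≤ a.re) (hg : ContDiff ℝ n g) :
    ContDiff ℝ n (fun R => ∫ t in (0 : ℝ)..1, (t : ℂ) ^ a * g (R * t)) := by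
  induction n using ENat.recTopCoe with
  | top => exact contDiff_infty.2 fun n => contDiff_eulerCpow n a g ha (hg.of_le (by exact_mod_cast le_top))
  | coe n => exact contDiff_eulerCpow n a g ha hg

/-! ## The Euler identity -/

/-- THE EULER IDENTITY: for `g ∈ C¹` and `Re a ≥ 0`, `Y(R) = ∫₀¹ t^a g(Rt) dt` satisfies
`R·Y′(R) = −(a+1)·Y(R) + g(R)` for every `R` (integration by parts of `d/dt (t^{a+1} g(Rt))` on `[0, 1]`; the
boundary term at `0` vanishes since `Re(a+1) > 0`). [folklore] -/
theorem eulerCpow_identity {a : ℂ} (ha : 0 ≤ a.re) {g : ℝ → ℂ} (hg : ContDiff ℝ 1 g) (R : ℝ) :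
    (R : ℂ) * deriv (fun R => ∫ t in (0 : ℝ)..1, (t : ℂ) ^ a * g (R * t)) R =
      -(a + 1) * (∫ t in (0 : ℝ)..1, (t : ℂ) ^ a * g (R * t)) + g R := by
  have hgc : Continuous g := hg.continuous
  have hg' : Continuous (deriv g) := hg.continuous_deriv le_rfl
  have hgd : ∀ x, HasDerivAt g (deriv g x) x := fun x => (hg.differentiable (by simp) x).hasDerivAt
  have ha1 : 0 < (a + 1).re := by simp only [Complex.add_re, Complex.one_re]; linarith
  have ha1' : 0 ≤ (a + 1).re := ha1.le
  have ha10 : a + 1 ≠ 0 := fun h => by rw [h, Complex.zero_re] at ha1; exact lt_irrefl _ ha1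
  rw [(hasDerivAt_eulerCpow ha hg R).deriv]
  -- the two integrands are integrable
  have hint : ∀ {b : ℂ}, 0 ≤ b.re → ∀ {k : ℝ → ℂ}, Continuous k →
      IntervalIntegrable (fun t : ℝ => (t : ℂ) ^ b * k (R * t)) volume 0 1 := by
    intro b hb k hk
    obtain ⟨C₀, -, hC₀⟩ := exists_bound_abs_le hk |R|
    refine IntervalIntegrable.mono_fun' (intervalIntegrable_const (c := C₀)) (eulerCpow_meas b hk R) ?_
    rw [EventuallyLE, ae_restrict_iff' measurableSet_uIoc]
    exact Eventually.of_forall fun t ht => eulerCpow_bound hb le_rfl hC₀ (by rwa [uIoc_of_le zero_le_one] at ht)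
  have hint0 := hint ha hgc
  have hint1 := hint ha1' hg'
  -- integration by parts
  set Φ : ℝ → ℂ := fun t => (t : ℂ) ^ (a + 1) * g (R * t) with hΦ
  set Φ' : ℝ → ℂ := fun t => (a + 1) * ((t : ℂ) ^ a * g (R * t)) + (R : ℂ) * ((t : ℂ) ^ (a + 1) * deriv g (R * t))
    with hΦ'
  have hΦder : ∀ t ∈ Ioo (0 : ℝ) 1, HasDerivAt Φ (Φ' t) t := by
    intro t ht
    have h1 : HasDerivAt (fun s : ℝ => (s : ℂ) ^ (a + 1)) ((a + 1) * (t : ℂ) ^ (a + 1 - 1)) t :=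
      (Complex.hasStrictDerivAt_cpow_const (c := a + 1) (Complex.ofReal_mem_slitPlane.2 ht.1)).hasDerivAt.comp_ofReal
    rw [add_sub_cancel_right] at h1
    have h2 : HasDerivAt (fun s : ℝ => g (R * s)) ((R : ℝ) • deriv g (R * t)) t :=
      (hgd (R * t)).scomp t (hasDerivAt_const_mul R |>.congr_deriv (by simp))
    rw [Complex.real_smul] at h2
    refine (h1.mul h2).congr_deriv ?_
    simp only [hΦ']
    ring
  have hΦcont : Continuous Φ := by
    refine continuous_iff_continuousAt.2 fun t => ?_
    exact (Complex.continuousAt_ofReal_cpow_const t (a + 1) (Or.inl ha1)).mul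
      (hgc.continuousAt.comp (continuous_const.mul continuous_id).continuousAt)
  have hΦ0 : Φ 0 = 0 := by simp only [hΦ, Complex.ofReal_zero, Complex.zero_cpow ha10, zero_mul]
  have hΦ1 : Φ 1 = g R := by simp [hΦ]
  have hFTC := intervalIntegral.integral_eq_sub_of_hasDerivAt_of_le zero_le_one hΦcont.continuousOn hΦder
    ((hint0.const_mul (a + 1)).add (hint1.const_mul (R : ℂ)))
  have hsplit : (∫ t in (0 : ℝ)..1, Φ' t) = (a + 1) * (∫ t in (0 : ℝ)..1, (t : ℂ) ^ a * g (R * t)) +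
      (R : ℂ) * ∫ t in (0 : ℝ)..1, (t : ℂ) ^ (a + 1) * deriv g (R * t) := by
    simp only [hΦ']
    rw [intervalIntegral.integral_add (hint0.const_mul _) (hint1.const_mul _), intervalIntegral.integral_const_mul,
      intervalIntegral.integral_const_mul]
  rw [hΦ1, hΦ0, sub_zero, hsplit] at hFTC
  linear_combination hFTC

/-! ## Local versions on `(−δ, δ)` -/

/-- For every `R₀ ∈ (−δ, δ)` there are a radius `r` with `|R₀| < r < δ`, a global `C^n` function `g` equal to `h` on
`[−r, r]`, and a neighbourhood of `R₀` on which `E_a h = E_a g` (the integral only sees `h` on `[−|R|, |R|]`). [folklore] -/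
theorem eulerCpow_loc {n : ℕ∞} (a : ℂ) {h : ℝ → ℂ} {δ : ℝ} (hh : ContDiffOn ℝ n h (Ioo (-δ) δ)) {R₀ : ℝ}
    (hR₀ : R₀ ∈ Ioo (-δ) δ) : ∃ r, |R₀| < r ∧ r < δ ∧ ∃ g : ℝ → ℂ, ContDiff ℝ n g ∧ EqOn g h (Icc (-r) r) ∧
      (fun R => ∫ t in (0 : ℝ)..1, (t : ℂ) ^ a * h (R * t)) =ᶠ[𝓝 R₀]
        fun R => ∫ t in (0 : ℝ)..1, (t : ℂ) ^ a * g (R * t) := by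
  have hR₀' : |R₀| < δ := abs_lt.2 hR₀
  set r : ℝ := (|R₀| + δ) / 2 with hr
  have h1 : |R₀| < r := by rw [hr]; linarith
  have h2 : r < δ := by rw [hr]; linarith
  have hr0 : 0 < r := lt_of_le_of_lt (abs_nonneg _) h1
  obtain ⟨g, hg, hgh⟩ := exists_contDiff_eq_on_Icc hr0 h2 hh
  refine ⟨r, h1, h2, g, hg, hgh, ?_⟩
  have hnhds : Ioo (-r) r ∈ 𝓝 R₀ := isOpen_Ioo.mem_nhds (by rw [mem_Ioo, ← abs_lt]; exact h1)
  filter_upwards [hnhds] with R hR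
  refine integral_congr fun t ht => ?_
  rw [uIcc_of_le zero_le_one] at ht
  have hRt : R * t ∈ Icc (-r) r := by
    have hR' : |R| < r := abs_lt.2 hR
    have : |R * t| ≤ |R| := by
      rw [abs_mul, abs_of_nonneg ht.1]; exact mul_le_of_le_one_right (abs_nonneg R) ht.2
    constructor <;> linarith [(abs_le.1 (this.trans hR'.le)).1, (abs_le.1 (this.trans hR'.le)).2]
  simp only [hgh hRt]

/-- LOCAL `C^n` SMOOTHNESS: if `h` is `C^n` on `(−δ, δ)` and `Re a ≥ 0` then `R ↦ ∫₀¹ t^a h(Rt) dt` is `C^n` on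
`(−δ, δ)`. [folklore] -/
theorem contDiffOn_eulerCpow_local {n : ℕ∞} {a : ℂ} (ha : 0 ≤ a.re) {h : ℝ → ℂ} {δ : ℝ}
    (hh : ContDiffOn ℝ n h (Ioo (-δ) δ)) :
    ContDiffOn ℝ n (fun R => ∫ t in (0 : ℝ)..1, (t : ℂ) ^ a * h (R * t)) (Ioo (-δ) δ) := by
  intro R₀ hR₀
  obtain ⟨r, -, -, g, hg, -, hev⟩ := eulerCpow_loc a hh hR₀
  exact ((contDiff_eulerCpow' ha hg).contDiffAt.congr_of_eventuallyEq hev).contDiffWithinAt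

/-- **Registered helper `eulerCpow_local`: THE LOCAL EULER PACKAGE WITH A COMPLEX WEIGHT.** For `Re a ≥ 0`, `δ > 0` and
`h` of class `C^∞` on `(−δ, δ)`, `Y(R) = ∫₀¹ t^a h(Rt) dt` is of class `C^∞` on `(−δ, δ)` and
`R·Y′(R) = −(a+1)·Y(R) + h(R)` there; moreover `‖Y(R)‖ ≤ C` whenever `‖h(s)‖ ≤ C` for `|s| ≤ |R|`. [folklore] -/
theorem eulerCpow_local : ∀ (a : ℂ) (δ : ℝ) (h : ℝ → ℂ), 0 ≤ a.re → 0 < δ → ContDiffOn ℝ ∞ h (Set.Ioo (-δ) δ) → ContDiffOn ℝ ∞ (fun R => ∫ t in (0 : ℝ)..1, (t : ℂ) ^ a * h (R * t)) (Set.Ioo (-δ) δ) ∧ (∀ R ∈ Set.Ioo (-δ) δ, (R : ℂ) * deriv (fun R => ∫ t in (0 : ℝ)..1, (t : ℂ) ^ a * h (R * t)) R = -(a + 1) * (∫ t in (0 : ℝ)..1, (t : ℂ) ^ a * h (R * t)) + h R) ∧ ∀ R : ℝ, ∀ C : ℝ, (∀ s, |s| ≤ |R| → ‖h s‖ ≤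 C) → ‖∫ t in (0 : ℝ)..1, (t : ℂ) ^ a * h (R * t)‖ ≤ C := by
  intro a δ h ha _ hh
  refine ⟨contDiffOn_eulerCpow_local ha hh, fun R₀ hR₀ => ?_, fun R C hC => norm_eulerCpow_le ha hC⟩
  obtain ⟨r, h1, -, g, hg, hgh, hev⟩ := eulerCpow_loc a hh hR₀
  have hR₀r : R₀ ∈ Icc (-r) r := ⟨by linarith [(abs_lt.1 h1).1], by linarith [(abs_lt.1 h1).2]⟩
  rw [hev.deriv_eq, hev.eq_of_nhds, ← hgh hR₀r]
  exact eulerCpow_identity ha (hg.of_le (by exact_mod_cast le_top)) R₀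

end Summit.AtomisticToContinuum.HydrodynamicLimit.Theorems.SonicCavityRenewal

end
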